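/-
Copyright (c) 2026. All rights reserved.
Released under Apache 2.0 license as described in the file LICENSE.
Authors: abc-iut cell, F-wave seat abc-iut-f-101 (gen 6), over the statements of abc-iut-L4-t3 (the `⋉`-successor interface),
abc-iut-w5-d144 (the typed clause `Cor510MonoTelecoreObservablesCompatible`, the observables over `Th•[Z]`), abc-iut-L4-t8 (the
E-instance at the frozen genuine carrier, the `toLtimes` transfers of the coherence data) and abc-iut-L4-t11 (`IotaOver.toLtimes`,
`TSHomotopies.toLtimes`).
-/
import Literature.AnabelianGeometry.AbsoluteAnabelian.Ltimes.LogFrobeniusMonoTelecoreObservablesOf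
import Literature.AnabelianGeometry.AbsoluteAnabelian.Ltimes.LogFrobeniusMonoTelecoreObservablesOverBridge
import Literature.AnabelianGeometry.AbsoluteAnabelian.Ltimes.LogFrobeniusMonoTelecoreObservablesOverBridgeTS
import Literature.AnabelianGeometry.AbsoluteAnabelian.Ltimes.LogFrobeniusObservablesOverGenerators
import Literature.AnabelianGeometry.AbsoluteAnabelian.Ltimes.LogFrobeniusObservablesTSOverGenerators
import Literature.AnabelianGeometry.AbsoluteAnabelian.Ltimes.LogFrobeniusObservablesTSPushSubFamily
import Literature.AnabelianGeometry.AbsoluteAnabelian.Ltimes.LogFrobeniusMonoTelecoreContactObservablesCarriers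
import Literature.AnabelianGeometry.AbsoluteAnabelian.Ltimes.LogFrobeniusRestrictCoherence
import Literature.AnabelianGeometry.AbsoluteAnabelian.LogFrobeniusMonoTelecoreObservablesGenuineOpen
import HarnessLib

/-!
# [AbsTopIII] Cor 5.10 (iv)(b), last sentence («compatible with `S_log`, `S_log⊞`») over the `⋉`-successor, AT THE CARRIERS

S. Mochizuki, *Topics in absolute anabelian geometry III*, J. Math. Sci. Univ. Tokyo 22 (2015) [MochizukiAbsTopIII2015],
Cor 5.10 (iv)(b) pp. 147–148 (manuscript `paper:url-5493eb38cbb7`): «… a telecore structure `𝔗_{An⊢}` on `D•⊢` … Moreover,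
the respective family of homotopies of `𝔗_{An⊢}` and the observables `S_log`, `S_log⊞` of Cor 5.5 (iii) are compatible.»

Cell slice T9-E «OBS@⋉-CARRIERS» (L4-lead m191 (3) / m197): abc-iut-f-101's sufficiency theorem over the successor
(`Ltimes/LogFrobeniusMonoTelecoreObservablesOf`: `LogFrobeniusSettingLtimes.cor510MonoTelecoreObservablesCompatible_of`) with
EVERY binder discharged at the restricted genuine open-augmentation carrier `(genuineOpen p V).toLtimes`, exactly as abc-iut-L4-t8
did at the frozen carrier (`LogFrobeniusMonoTelecoreObservablesGenuineOpen`):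

* §1 transfers along `toLtimes` of the three remaining add-on / observable CONDITIONS: ★ `IotaSquaresCommute.toLtimes` (the
  commuting `ι⊞`-squares of Def 5.4 (iii): the `⋉`-statement quantifies over the SUB-family `LogEdgeLtimes ⊆ LogEdge` of edges and
  `L.toLtimes.iota v ε = L.iota v ε.toOld` on the nose), `LamOverLink.toLtimes` (no `ι⊞` involved: verbatim),
  `TSHomotopies.IotaOverTS.toLtimes` (the `TS`-valued `ι` are unchanged; `lamTwistOver` transfers by abc-iut-L4-t11's
  `toLtimes_lamTwistOver`);
* §2 the two Cor 5.5 (iii) observable STRUCTURES over `⋉` at the carrier — «(α)» of L4-lead m197: `iotaSquaresCommute_openLtimes`,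
  `cor55Observables_openLtimes`, `iotaSquaresCommuteTS_openLtimes`, `cor55ObservablesTS_openLtimes` (for EVERY `TS`-datum), the
  universal families `logObsFamily` / `logObsFamilyTS` being observables there;
* §3 ★★ `cor510MonoTelecoreObservablesCompatible_openLtimes_of_iotaOverTS` (every `TS`-datum whose `ι` lie over `Th•[Z]`),
  ★★ `cor510MonoTelecoreObservablesCompatible_openLtimes` (the carrier's own `TS`-datum `(genuineOpenTS p V).toLtimes`; ZERO
  hypotheses beyond `V ≠ ∅`) and the `_iff_nonempty` form.

The TWO-SIDED setting of record `genuineTwoSidedSumLtimes p 𝔄 V₁ V₂` needs, in addition, the summand-wise glue of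
`IotaSquaresCommute`, `LamOverLink`, `IotaOverTS` and of the observables' over-`Th•[Z]` bridges across abc-iut-w6-d025's sum — not
in this file (the (α) structures and s_b′ at the sum are the follow-on file of this slice).
MODEL-LEVEL (a carrier of OUR successor typing); refereed pre-IUT material; nothing here bears on [IUTchIII] Cor. 3.12; no side
taken; instantiated ≠ endorsed; typed ≠ proved.
-/

set_option autoImplicit false

universe u

open CategoryTheory Quiver

namespace Literature.AnabelianGeometry.AbsoluteAnabelian

/-! ## §1. Transfers along `toLtimes` -/

namespace LogFrobeniusSetting

variable {Vmod : Type u} {isArc : Vmod → Bool} (L : LogFrobeniusSetting Vmod isArc)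

/-- ★ **the commuting `ι⊞`-squares restrict along `toLtimes`**: the `⋉`-condition quantifies over 2-chains of `⋉`-edges, a
sub-family of the frozen edges (`LogEdgeLtimes.toOld`), and the restricted carrier's `ι⊞_{v,ε}` IS `ι⊞_{v,ε.toOld}`.
[cite: MochizukiAbsTopIII2015, Def 5.4 (iii) p. 126] -/
theorem IotaSquaresCommute.toLtimes {v : Vmod} (h : L.IotaSquaresCommute v) : L.toLtimes.IotaSquaresCommute v :=
  fun _ _ _ _ h₁ h₂ h₂' h₃ ε₁₂ ε₂₃ ε₁₂' ε₂'₃ X₀ m₁₂ m₂₃ m₁₂' m₂'₃ hm₁₂ hm₂₃ hm₁₂' hm₂'₃ =>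
    h h₁ h₂ h₂' h₃ ε₁₂.toOld ε₂₃.toOld ε₁₂'.toOld ε₂'₃.toOld X₀ m₁₂ m₂₃ m₁₂' m₂'₃ hm₁₂ hm₂₃ hm₁₂' hm₂'₃

/-- **the add-on law «`λ⊞_{space-link}` and `λ⊞_{post-log}` have the same over-structure» restricts along `toLtimes`** (no `ι⊞`
involved: the same data). [cite: MochizukiAbsTopIII2015, Cor 5.5 p. 130] -/
theorem LamOverLink.toLtimes (h : L.LamOverLink) : L.toLtimes.LamOverLink :=
  fun v => h v

/-- **«the `TS`-valued `ι_{v,ε}` lie over `Th•[Z]`» restricts along `toLtimes`** (the same `ι_{v,ε}` on every edge of `Γ⃗^log_v`;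
`lamTwistOver` transfers by `toLtimes_lamTwistOver`). [cite: MochizukiAbsTopIII2015, Def 5.4 (vii) p. 128] -/
theorem TSHomotopies.IotaOverTS.toLtimes {T : L.TSHomotopies} (h : T.IotaOverTS) : (T.toLtimes).IotaOverTS := by
  intro v ν₁ ν₂ ε
  rw [toLtimes_lamTwistOver]
  exact h v ε

end LogFrobeniusSetting

/-! ## §2. «(α)»: the two Cor 5.5 (iii) observable structures over `⋉` at `(genuineOpen p V).toLtimes` -/

namespace LogFrobeniusSetting

open AbsTopIII DiagramOfCategories

section OpenLtimes

variable (p : ℕ) [Fact p.Prime] (Vmod : Type 1)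

/-- the commuting `ι⊞`-squares at the restricted genuine carrier (abc-iut-w5-d053's genuine square, read over `⋉`).
[cite: MochizukiAbsTopIII2015, Def 5.4 (iii) p. 126] -/
theorem iotaSquaresCommute_openLtimes (v : Vmod) : (genuineOpen p Vmod).toLtimes.IotaSquaresCommute v :=
  IotaSquaresCommute.toLtimes _ (genuineOpen_iotaSquaresCommute p Vmod v)

/-- ★ **Cor 5.5 (iii) `⊞`-half HOLDS at the restricted genuine carrier, over `⋉`**: the universal family `logObsFamily` is an
observable `S_log⊞_v` at every `v`. [cite: MochizukiAbsTopIII2015, Cor 5.5 (iii) p. 131] -/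
theorem cor55Observables_openLtimes : (genuineOpen p Vmod).toLtimes.Cor55Observables :=
  (genuineOpen p Vmod).toLtimes.cor55Observables_of_iotaSquaresCommute (iotaSquaresCommute_openLtimes p Vmod)

/-- the `TS` ι-diamond law at the restricted genuine carrier, for EVERY `TS`-datum over `⋉` (from the `⊞`-squares, by
abc-iut-w5-d144's reduction over `⋉`). [cite: MochizukiAbsTopIII2015, Def 5.4 (vii) p. 128] -/
theorem iotaSquaresCommuteTS_openLtimes (T : (genuineOpen p Vmod).toLtimes.TSHomotopies) (v : Vmod) :
    (genuineOpen p Vmod).toLtimes.IotaSquaresCommuteTS T v :=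
  (genuineOpen p Vmod).toLtimes.iotaSquaresCommuteTS_of_iotaSquaresCommute v T (iotaSquaresCommute_openLtimes p Vmod v)

/-- ★ **Cor 5.5 (iii) `TS`-half HOLDS at the restricted genuine carrier, over `⋉`, for EVERY `TS`-datum**: the universal family
`logObsFamilyTS` is an observable `S_log_v` at every `v`. [cite: MochizukiAbsTopIII2015, Cor 5.5 (iii) p. 131] -/
theorem cor55ObservablesTS_openLtimes (T : (genuineOpen p Vmod).toLtimes.TSHomotopies) :
    (genuineOpen p Vmod).toLtimes.Cor55ObservablesTS T :=
  (genuineOpen p Vmod).toLtimes.cor55ObservablesTS_of_iotaSquaresCommute T (iotaSquaresCommute_openLtimes p Vmod)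

/-- the two observable structures at the carrier, as the pair of `IsLogObservable…` facts for the universal families (the `hobs`
binder of the sufficiency theorem). [cite: MochizukiAbsTopIII2015, Cor 5.5 (iii) p. 131] -/
theorem isLogObservable_pair_openLtimes (T : (genuineOpen p Vmod).toLtimes.TSHomotopies) (v : Vmod) :
    (genuineOpen p Vmod).toLtimes.IsLogObservablePlus v
        ((genuineOpen p Vmod).toLtimes.logObsFamily v (iotaSquaresCommute_openLtimes p Vmod v)) ∧
      (genuineOpen p Vmod).toLtimes.IsLogObservableTS T v
        ((genuineOpen p Vmod).toLtimes.logObsFamilyTS v T (iotaSquaresCommuteTS_openLtimes p Vmod T v)) :=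
  ⟨(genuineOpen p Vmod).toLtimes.isLogObservablePlus_logObsFamily v _,
    (genuineOpen p Vmod).toLtimes.isLogObservableTS_logObsFamilyTS v T _⟩

/-- `LamOverLink` at the restricted genuine carrier (abc-iut-w5-d144's, read over `⋉`). [cite: MochizukiAbsTopIII2015, Cor 5.5 p. 130] -/
theorem lamOverLink_openLtimes : (genuineOpen p Vmod).toLtimes.LamOverLink :=
  LamOverLink.toLtimes _ (nonarchGenuineMonoAnPfOpen_lamOverLink p Vmod (fun _ => false))

/-! ## §3. Cor 5.10 (iv)(b), «compatible with `S_log`, `S_log⊞`», at `(genuineOpen p V).toLtimes` -/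

/-- **`hoverPlus` at the restricted carrier**: every homotopy of the universal `⊞`-observable family, read inside `D_{An⊢}`, lies
over the core for the mono-telecore over-datum (`hN := Iso.refl`, `hψ := nonarchGenuineMonoAnPfOpen_ψOverIso`) — abc-iut-f-101's
bridge over abc-iut-w5-d144's `isOver_logObsFamily_η_map`, both over `⋉`. [cite: MochizukiAbsTopIII2015, Remark 3.5.1 p.78] -/
theorem isOver_embPlusHom_openLtimes (v : Vmod) (a : (LogFrobeniusSettingLtimes.logShapePlus (isArc := fun _ : Vmod => false) v).Vertex)
    (q r : Path a (LogFrobeniusSettingLtimes.logShapePlus (isArc := fun _ : Vmod => false) v).obs)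
    (h : ((genuineOpen p Vmod).toLtimes.logObsFamily v (iotaSquaresCommute_openLtimes p Vmod v)).E q r) :
    ((genuineOpen p Vmod).toLtimes.monoTeleOver (fun _ => Iso.refl _)
        (fun w j => nonarchGenuineMonoAnPfOpen_ψOverIso p Vmod (fun _ => false) w j)).IsOver
      ((LogFrobeniusSettingLtimes.embMonoPlus (monoJ (Vmod := Vmod)) v).mapPath q)
      ((LogFrobeniusSettingLtimes.embMonoPlus (monoJ (Vmod := Vmod)) v).mapPath r)
      ((genuineOpen p Vmod).toLtimes.embPlusHom v
        ((genuineOpen p Vmod).toLtimes.logObsFamily v (iotaSquaresCommute_openLtimes p Vmod v)) h) :=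
  (genuineOpen p Vmod).toLtimes.isOver_embPlusHom_of_isOver _ _ v _
    (fun h' => (genuineOpen p Vmod).toLtimes.isOver_logObsFamily_η_map v (iotaOver_openLtimes p Vmod)
      (lamOverLink_openLtimes p Vmod) _ _ h') a q r h

/-- **`hoverTS` at the restricted carrier**, for every `TS`-datum `T` over `⋉` whose `ι` lie over `Th•[Z]`.
[cite: MochizukiAbsTopIII2015, Remark 3.5.1 p.78] -/
theorem isOver_embTSHom_openLtimes (T : (genuineOpen p Vmod).toLtimes.TSHomotopies) (hT : T.IotaOverTS) (v : Vmod)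
    (a : (logShapeTS (isArc := fun _ : Vmod => false) v).Vertex)
    (q r : Path a (logShapeTS (isArc := fun _ : Vmod => false) v).obs)
    (h : ((genuineOpen p Vmod).toLtimes.logObsFamilyTS v T (iotaSquaresCommuteTS_openLtimes p Vmod T v)).E q r) :
    ((genuineOpen p Vmod).toLtimes.monoTeleOver (fun _ => Iso.refl _)
        (fun w j => nonarchGenuineMonoAnPfOpen_ψOverIso p Vmod (fun _ => false) w j)).IsOver
      ((embMonoTS (monoJ (Vmod := Vmod)) v).mapPath q) ((embMonoTS (monoJ (Vmod := Vmod)) v).mapPath r)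
      ((genuineOpen p Vmod).toLtimes.embTSHom v
        ((genuineOpen p Vmod).toLtimes.logObsFamilyTS v T (iotaSquaresCommuteTS_openLtimes p Vmod T v)) h) :=
  (genuineOpen p Vmod).toLtimes.isOver_embTSHom_of_isOver _ _ v _
    (fun h' => (genuineOpen p Vmod).toLtimes.isOver_logObsFamilyTS_η_map v T hT
      (lamOverLink_openLtimes p Vmod) _ _ h') a q r h

/-- ★★ **Cor 5.10 (iv)(b), «the family of homotopies of `𝔗_{An⊢}` and the observables `S_log`, `S_log⊞` are compatible», AT THE
RESTRICTED GENUINE OPEN-AUGMENTATION CARRIER over `⋉`, for every `TS`-datum `T` with `T.IotaOverTS`** (`V ≠ ∅`): ONE family of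
homotopies on `D_{An⊢}` contains `𝒥` and the embedded `S_log⊞_v`, `S_log_v` at every `v` — abc-iut-f-101's sufficiency theorem
over `⋉` with every binder discharged at the carrier. [cite: MochizukiAbsTopIII2015, Cor 5.10 (iv)(b) p. 147] -/
theorem cor510MonoTelecoreObservablesCompatible_openLtimes_of_iotaOverTS [Nonempty Vmod]
    (T : (genuineOpen p Vmod).toLtimes.TSHomotopies) (hT : T.IotaOverTS) :
    (genuineOpen p Vmod).toLtimes.Cor510MonoTelecoreObservablesCompatible T :=
  (genuineOpen p Vmod).toLtimes.cor510MonoTelecoreObservablesCompatible_of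
    (TS := T)
    (hN := fun _ => Iso.refl _)
    (hψ := fun w j => nonarchGenuineMonoAnPfOpen_ψOverIso p Vmod (fun _ => false) w j)
    (Hplus := fun v => (genuineOpen p Vmod).toLtimes.logObsFamily v (iotaSquaresCommute_openLtimes p Vmod v))
    (Hts := fun v => (genuineOpen p Vmod).toLtimes.logObsFamilyTS v T (iotaSquaresCommuteTS_openLtimes p Vmod T v))
    (hpush := fun v => (genuineOpen p Vmod).toLtimes.subFamily_pushFamily_logObsFamilyTS v T _ _)
    (hoverPlus := fun v a q r h => isOver_embPlusHom_openLtimes p Vmod v a q r h)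
    (hoverTS := fun v a q r h => isOver_embTSHom_openLtimes p Vmod T hT v a q r h)
    (hobs := fun v => isLogObservable_pair_openLtimes p Vmod T v)

/-- ★★ **… with the carrier's own `TS`-datum `(genuineOpenTS p V).toLtimes`** — ZERO hypotheses beyond `V ≠ ∅`.
[cite: MochizukiAbsTopIII2015, Cor 5.10 (iv)(b) p. 147] -/
theorem cor510MonoTelecoreObservablesCompatible_openLtimes [Nonempty Vmod] :
    (genuineOpen p Vmod).toLtimes.Cor510MonoTelecoreObservablesCompatible (genuineOpenTS p Vmod).toLtimes :=
  cor510MonoTelecoreObservablesCompatible_openLtimes_of_iotaOverTS p Vmod _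
    (TSHomotopies.IotaOverTS.toLtimes _ (genuineOpenTS_iotaOverTS p Vmod))

/-- **… EXACTLY iff `V ≠ ∅`** (abc-iut-w5-d144's degenerate corner over `⋉`). [cite: MochizukiAbsTopIII2015, Cor 5.10 (iv)(b) p. 147] -/
theorem cor510MonoTelecoreObservablesCompatible_openLtimes_iff_nonempty :
    (genuineOpen p Vmod).toLtimes.Cor510MonoTelecoreObservablesCompatible (genuineOpenTS p Vmod).toLtimes ↔ Nonempty Vmod := by
  refine ⟨fun h => ?_, fun _ => cor510MonoTelecoreObservablesCompatible_openLtimes p Vmod⟩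
  by_contra hne
  haveI : IsEmpty Vmod := not_nonempty_iff.mp hne
  exact (genuineOpen p Vmod).toLtimes.not_cor510MonoTelecoreObservablesCompatible_of_isEmpty _ h

end OpenLtimes

end LogFrobeniusSetting

end Literature.AnabelianGeometry.AbsoluteAnabelian
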